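import Summits.ResolutionOfSingularities.ResolutionOfSingularities.Theorems.DeltaCutGradeCertificates3
import HarnessLib

/-!
# DeltaCutMirror1 (tree file 1/3 of the lens-6 g29 node «MirrorCut», HOME decomp-res-lens-6/g29/MirrorCut.lean) —
decomp-res lens-6 g29 NODE «MirrorCut» (barrier certificate for the column's technique class)

HOME file `decomp-res-lens-6/g29/MirrorCut.lean` (ring level; imports the LANDED `DeltaCutGradeCertificates3`, nothing
carried; namespace `…Theorems.DeltaCutClasses`, NEW sections `MCertificatesA/B/C`).  Companion: `NODE-g29.md` (the barrier
theorem with its hand proof, the repair census, the literature placement), `NEXT-g30.md`.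

## The datum

`D′_p := z^p + u·t^p·w^p` on `𝔸⁴_K = Spec K[z,t,u,w]`, `char K = p` (coordinates `0 = z, 1 = t, 2 = u, 3 = w`; the decided
certificates below are for `p = 3`: `D′ = z³ + u·t³·w³`; the identities of §A hold for every exponent `p`).

## What is certified here (dictionary of `DeltaCutSepCertificates` §SepCertificates: (ord) `∃ s ∉ 𝔮, s·g ∈ 𝔮^m`; (L) Rees
charts of coordinate linear centres `linChartSubst A e`; (R) coordinate linear subspaces are regular, an intersection of two
prime ideals that is not prime «at» a point of their sum is not regular there; (E) translations / étale-local coordinates;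
NEAR = transform `∈ 𝔫'³` at a chart origin with a generic cofactor) — and ONE new dictionary line (B″): for a generator `f`
with PRIME-FIELD coefficients the absolute differential closure of order `≤ 2 < p` of `(f)` is the ideal `(f, ∂ᵢf, ∂ᵢ∂ⱼf)`
(Hasse operators of order `≤ 2` are `∂ᵢ`, `∂ᵢ∂ⱼ`, `½∂ᵢ²`; derivations of `K` kill prime-field coefficients), so
`(f, ∂ᵢf, ∂ᵢ∂ⱼf) ⊆ 𝓘(Z)³` along a closed `Z ⊆ top` means NO point of `Z` is an absolute contact point.

* §A (`MCertificatesA`, every `p`): MIRROR `σ = (t ↔ w)` fixes `D′`; FROBENIUS SHEAR `τ_c : z ↦ z − c·t·w, u ↦ u + c^p` fixes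
  `D′` for EVERY `c` (char `p`); the scalings `μ_λ : (u,w) ↦ (λ^{-p}u, λw)` fix `D′`; SELF-REPRODUCTION: the blow-up of the
  crossing line `L = V(z,t,w)`, chart `t` (and chart `w`): the total transform is `t^p·D′` — the controlled transform is `D′`
  LITERALLY, on the whole chart; chart `z`: `z^p·(1 + u·t^p·w^p·z^p)`; `D′ ∈ 𝓘(P_t)^p ∩ 𝓘(P_w)^p` (`P_t = V(z,t)`, `P_w =
  V(z,w)`); the MEMORY COMPOSITE charts: blowing up the old plane `V(z,w)` in chart `t` gives `w^p·(z^p + u·t^p)` / `z^p·(1 +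
  u·t^p·w^p)`, and blowing up the plane `V(z,t)` of `z^p + u·t^p` gives `t^p·(z^p + u)` / `z^p·(1 + u·t^p)`.
* §B (`MCertificatesB`, `p = 3`): (T) top `⊆ P_t ∪ P_w` (`Dm_top`, characteristic-free); (W) `D′ ∈ P_t³ ∩ P_w³`, both
  planes are planes; (B″) `∂ᵢD′ = [i = u]·t³w³`, `∂ᵢ(t³w³) = 0` (char 3): `Diff^{≤2}(D′) = (D′, t³w³) ⊆ P_t³ ∩ P_w³` — EVERY
  point of `P_t ∪ P_w` is BAD (no absolute stalk contact); (N) every closed point `(0,0,a,b)` of `P_t` (and, by `σ`, of `P_w`)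
  has a NEAR point (chart `u`: `z'³ + Φ·t'³ ∈ 𝔫'³` for every cofactor); (R) the reduced closure `V((z,t) ∩ (z,w))` of bad₀
  is NOT REGULAR at the origin (`t·w ∈`, `t, w ∉`) — indeed along the whole crossing line `(z,t) + (z,w) = (z,t,w) = 𝓘(L)`,
  a LINE (`u ∉`); not a curve (contains the plane `P_t`); and the surface part (= the whole closure, pure dimension 2) is
  that same irregular surface.  So `GFrozen 3 ⟨(𝔸⁴,(D′)), none⟩` at g-height `0`: `D′` INHABITS F-surf-sing, of CROSSING
  type (two regular components through a line) — beside g28's irreducible inhabitant `H = z³ + (t²w − u²)⁴`.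
  NO-TOP lemmas for the unit-form charts (`1 + u·m`, `∂_u m = 0`).
* §C (`MCertificatesC`, `p = 3`): the MEMORY PRICE — the composite [blow up `L`; then the strict transforms of the two OLD
  planes; then the two NEW exceptional planes] decides `D′` at height `3` in every chart: level-2 germ `z³ + u·t³` has top =
  bad = the plane `V(z,t)` (REGULAR closure: even the memoryless separating hop fires there), level-3 germs `z³ + u`, `1 +
  u·t³`, `1 + u·t³w³` have NO top point.

## The barrier these certificates carry (statement; proof in NODE-g29.md §2)

Call a hop law ADMISSIBLE for the column if it is (a) MEMORYLESS — a function of the stage `(Y, 𝓘, n)` alone; (b) LOCAL —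
compatible with open immersions / smooth surjective base change (all tree laws are: bad locus, closure, singular locus,
surface part, dimension tests commute with them); (c) EQUIVARIANT under automorphisms of the stage; (d) ONE REGULAR CENTRE
inside the top locus per hop (controlled transform defined).  THEOREM (MirrorCut barrier).  For every admissible law `Λ` and
every field `K` of characteristic `p`, the run of `Λ` from `(𝔸⁴_K, (D′_p), p)` never reaches a level with empty bad locus:
either `Λ` declines at `D′` (FREEZES — every tree law `runHop`, `sepHop`, `refHop`, `gHop` does, by §B), or `Λ` blows up
`L` (the ONLY `Aut`-stable nonempty regular closed subscheme of the top locus `P_t ∪ P_w` over `K̄`: `τ_c`, `μ` act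
transitively on the geometric points of `L` and of `(P_t ∪ P_w) ∖ L`, `σ` swaps the planes, `P_t ∪ P_w` is singular along
`L`), and then (§A self-reproduction) level `1` contains two disjoint open charts each isomorphic to `(𝔸⁴_K, (D′_p))`, on
which `Λ` — by (b) — does the same again: level `i` carries `2^i` copies of `D′`, the bad locus is never empty (CYCLE).
Consequently `E1TopGFrozen` (hence `E1TopGHeavy`, `E1TopNoAbs`) is NOT decided by any refinement of the column inside the
class (a)–(d); the missing input is MEMORY (at least: which components of the top locus are old), and §C certifies that
ONE BIT of it decides `D′` (height 3).  The characteristic-`p` engine is the Frobenius shear `τ_c` (absorbing `c^p` into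
`u`): in characteristic `0` the analogous `z^n + u·t^n·w^n` has the DISTINGUISHED closed point `u = 0` on `L` (order jumps),
and the origin-first laws of characteristic zero are admissible there.

(Sources: Hironaka1964 (permissibility, normal crossings with the exceptional locus); Giraud1975; BierstoneMilman1997
(invariant with year-of-birth of exceptional hypersurfaces); EncinasVillamayor2000 / BravoEncinasVillamayor2005 (basic objects
`(W,(J,b),E)`); Wlodarczyk2005 (marked ideals, §2 «the role of E»); Kollar2007 §3.2–§3.6; CossartJannsenSaito2020 Ch. 5–8
(`O(x)`, old components, `B`-permissibility); CossartPiltant2019 Prop. 2.6; Hauser2010 (kangaroo); Matsumura1987 §28–§31;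
StacksProject 0804 / 0BIQ / 035A.)
-/


noncomputable section

open CategoryTheory CategoryTheory.Limits AlgebraicGeometry TopologicalSpace IsLocalRing
open Literature.AlgebraicGeometry.Resolution

universe u

open Summit.ResolutionOfSingularities.ResolutionOfSingularities.Theorems.Rescue.BedZpeBinom4Centre (mul_mem_pow_add)

namespace Summit.ResolutionOfSingularities.ResolutionOfSingularities.Theorems.DeltaCutClasses

open Summit.ResolutionOfSingularities.ResolutionOfSingularities.Theorems.TwistCutClasses
open Summit.ResolutionOfSingularities.ResolutionOfSingularities.Theorems.LightCutClasses

section MCertificatesA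

open MvPolynomial
variable {K : Type*} [Field K]

/-! #### §A — `D′_p = z^p + u·t^p·w^p` for every exponent `p`: mirror, Frobenius shear, scalings, self-reproduction -/

/-- **THE MIRROR DATUM** `D′_p = z^p + u·t^p·w^p` (`0 = z, 1 = t, 2 = u, 3 = w`). DEFINITION (support; the certificates
below `p = 3` spell the polynomial out). -/
def mirrorF (p : ℕ) : MvPolynomial (Fin 4) K := X 0 ^ p + X 2 * X 1 ^ p * X 3 ^ p

/-- **MIRROR**: the coordinate swap `σ = (t ↔ w)` fixes `D′_p`. [new; elementary] [folklore] -/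
theorem mirrorF_swap (p : ℕ) : rename (Equiv.swap 1 3) (mirrorF (K := K) p) = mirrorF p := by
  simp [mirrorF, rename_X, Equiv.swap_apply_def]; ring

/-- **FROBENIUS SHEAR**: in characteristic `p`, `τ_c : z ↦ z − c·t·w, u ↦ u + c^p` fixes `D′_p` for EVERY scalar `c`
(`(z − c·t·w)^p = z^p − c^p·t^p·w^p`).  Over `K̄` the `τ_c` act TRANSITIVELY on the closed points of the crossing line
`L = V(z,t,w)`: no closed point of `L` is distinguished. [new; elementary] [folklore] -/
theorem mirrorF_shear (p : ℕ) [Fact p.Prime] [CharP K p] (c : K) :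
    aeval (fun j : Fin 4 => if j = 0 then (X 0 - C c * X 1 * X 3 : MvPolynomial (Fin 4) K)
        else if j = 2 then X 2 + C (c ^ p) else X j) (mirrorF (K := K) p) = mirrorF p := by
  simp only [mirrorF, map_add, map_mul, map_pow, aeval_X, Fin.isValue, if_true, show (2 : Fin 4) ≠ 0 by decide,
    show (1 : Fin 4) ≠ 0 by decide, show (1 : Fin 4) ≠ 2 by decide, show (3 : Fin 4) ≠ 0 by decide,
    show (3 : Fin 4) ≠ 2 by decide, if_false]
  rw [sub_pow_char (X 0 : MvPolynomial (Fin 4) K) (C c * X 1 * X 3)]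
  ring

/-- **SCALING** `μ_λ : u ↦ λ^{-p}·u, w ↦ λ·w` (`λ ≠ 0`) fixes `D′_p`; with `σ` the same holds for `(u,t) ↦ (λ^{-p}u, λt)`.
Over `K̄` these act transitively on the closed points of `P_t ∖ L` up to `τ` (and of `P_w ∖ L`). [new; elementary]
[folklore] -/
theorem mirrorF_scale (p : ℕ) {l : K} (hl : l ≠ 0) :
    aeval (fun j : Fin 4 => if j = 2 then (C ((l⁻¹) ^ p) * X 2 : MvPolynomial (Fin 4) K)
        else if j = 3 then C l * X 3 else X j) (mirrorF (K := K) p) = mirrorF p := by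
  have hC : ((C l⁻¹ : MvPolynomial (Fin 4) K) ^ p * C l ^ p : MvPolynomial (Fin 4) K) = 1 := by
    rw [← mul_pow, ← map_mul, inv_mul_cancel₀ hl, map_one, one_pow]
  simp only [mirrorF, map_add, map_mul, map_pow, aeval_X, Fin.isValue, if_true, show (0 : Fin 4) ≠ 2 by decide,
    show (0 : Fin 4) ≠ 3 by decide, show (1 : Fin 4) ≠ 2 by decide, show (1 : Fin 4) ≠ 3 by decide,
    show (3 : Fin 4) ≠ 2 by decide, if_false]
  linear_combination (X 2 * X 1 ^ p * X 3 ^ p : MvPolynomial (Fin 4) K) * hC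

/-- **`z`-SCALING** `z ↦ λz, u ↦ λ^p u` multiplies `D′_p` by the unit `λ^p` (the IDEAL `(D′_p)` is fixed). [new; elementary]
[folklore] -/
theorem mirrorF_scale_z (p : ℕ) (l : K) :
    aeval (fun j : Fin 4 => if j = 0 then (C l * X 0 : MvPolynomial (Fin 4) K)
        else if j = 2 then C (l ^ p) * X 2 else X j) (mirrorF (K := K) p) = C (l ^ p) * mirrorF p := by
  simp only [mirrorF, map_add, map_mul, map_pow, aeval_X, Fin.isValue, if_true, show (2 : Fin 4) ≠ 0 by decide,
    show (1 : Fin 4) ≠ 0 by decide, show (1 : Fin 4) ≠ 2 by decide, show (3 : Fin 4) ≠ 0 by decide,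
    show (3 : Fin 4) ≠ 2 by decide, if_false]
  ring

/-- **SELF-REPRODUCTION, chart `t`** of the blow-up of the crossing line `L = V(z,t,w)` (`z ↦ z·t, w ↦ w·t`): the total
transform of `D′_p` is `t^p · D′_p` — the controlled transform is `D′_p` LITERALLY, on the whole chart `𝔸⁴`. [new;
elementary] [folklore] -/
theorem mirrorF_lineChart_t (p : ℕ) :
    aeval (linChartSubst (K := K) {0, 1, 3} 1) (mirrorF (K := K) p) = X 1 ^ p * mirrorF p := by
  simp [mirrorF, linChartSubst]; ring

/-- **SELF-REPRODUCTION, chart `w`** (the mirror chart): total transform `w^p · D′_p`. [new; elementary] [folklore] -/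
theorem mirrorF_lineChart_w (p : ℕ) :
    aeval (linChartSubst (K := K) {0, 1, 3} 3) (mirrorF (K := K) p) = X 3 ^ p * mirrorF p := by
  simp [mirrorF, linChartSubst]; ring

/-- **chart `z`** of the same blow-up: total transform `z^p · (1 + u·t^p·w^p·z^p)` — a unit form (no top point, §B).
[new; elementary] [folklore] -/
theorem mirrorF_lineChart_z (p : ℕ) :
    aeval (linChartSubst (K := K) {0, 1, 3} 0) (mirrorF (K := K) p) = X 0 ^ p * (1 + X 2 * X 1 ^ p * X 3 ^ p * X 0 ^ p) := by
  simp [mirrorF, linChartSubst]; ring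

/-- **ORDER `≥ p` ALONG BOTH PLANES**: `D′_p ∈ 𝓘(P_t)^p` and `D′_p ∈ 𝓘(P_w)^p`. [new; elementary] [folklore] -/
theorem mirrorF_mem_pow (p : ℕ) :
    mirrorF (K := K) p ∈ (Ideal.span {(X 0 : MvPolynomial (Fin 4) K), X 1}) ^ p ∧
      mirrorF (K := K) p ∈ (Ideal.span {(X 0 : MvPolynomial (Fin 4) K), X 3}) ^ p := by
  have a0 : (X 0 : MvPolynomial (Fin 4) K) ∈ Ideal.span {(X 0 : MvPolynomial (Fin 4) K), X 1} := Ideal.subset_span (by simp)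
  have a1 : (X 1 : MvPolynomial (Fin 4) K) ∈ Ideal.span {(X 0 : MvPolynomial (Fin 4) K), X 1} := Ideal.subset_span (by simp)
  have b0 : (X 0 : MvPolynomial (Fin 4) K) ∈ Ideal.span {(X 0 : MvPolynomial (Fin 4) K), X 3} := Ideal.subset_span (by simp)
  have b3 : (X 3 : MvPolynomial (Fin 4) K) ∈ Ideal.span {(X 0 : MvPolynomial (Fin 4) K), X 3} := Ideal.subset_span (by simp)
  refine ⟨Ideal.add_mem _ (Ideal.pow_mem_pow a0 p) ?_, Ideal.add_mem _ (Ideal.pow_mem_pow b0 p) ?_⟩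
  · exact Ideal.mul_mem_right _ _ (Ideal.mul_mem_left _ _ (Ideal.pow_mem_pow a1 p))
  · exact Ideal.mul_mem_left _ _ (Ideal.pow_mem_pow b3 p)

/-- **MEMORY COMPOSITE, step 2, chart `w`**: in chart `t` of step 1 (polynomial `D′_p` again, exceptional divisor `V(t)`,
OLD planes' strict transform `V(z,w)`), blowing up `V(z,w)` (`z ↦ z·w`): total transform `w^p · (z^p + u·t^p)`. [new;
elementary] [folklore] -/
theorem mirrorF_oldPlaneChart_w (p : ℕ) :
    aeval (linChartSubst (K := K) {0, 3} 3) (mirrorF (K := K) p) = X 3 ^ p * (X 0 ^ p + X 2 * X 1 ^ p) := by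
  simp [mirrorF, linChartSubst]; ring

/-- step 2, chart `z` (`w ↦ w·z`): total transform `z^p · (1 + u·t^p·w^p)` — unit form. [new; elementary] [folklore] -/
theorem mirrorF_oldPlaneChart_z (p : ℕ) :
    aeval (linChartSubst (K := K) {0, 3} 0) (mirrorF (K := K) p) = X 0 ^ p * (1 + X 2 * X 1 ^ p * X 3 ^ p) := by
  simp [mirrorF, linChartSubst]; ring

/-- **MEMORY COMPOSITE, step 3, chart `t`**: blowing up the NEW plane `V(z,t)` of `z^p + u·t^p` (`z ↦ z·t`): total transform
`t^p · (z^p + u)` — order `≤ 1` everywhere (§C). [new; elementary] [folklore] -/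
theorem planeF_newPlaneChart_t (p : ℕ) :
    aeval (linChartSubst (K := K) {0, 1} 1) (X 0 ^ p + X 2 * X 1 ^ p : MvPolynomial (Fin 4) K) = X 1 ^ p * (X 0 ^ p + X 2) := by
  simp [linChartSubst]; ring

/-- step 3, chart `z` (`t ↦ t·z`): total transform `z^p · (1 + u·t^p)` — unit form. [new; elementary] [folklore] -/
theorem planeF_newPlaneChart_z (p : ℕ) :
    aeval (linChartSubst (K := K) {0, 1} 0) (X 0 ^ p + X 2 * X 1 ^ p : MvPolynomial (Fin 4) K) =
      X 0 ^ p * (1 + X 2 * X 1 ^ p) := by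
  simp [linChartSubst]; ring

end MCertificatesA

end Summit.ResolutionOfSingularities.ResolutionOfSingularities.Theorems.DeltaCutClasses
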